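import Summits.QuantumFields.YangMills.Theses.ParabolicTrajectory
import Literature.MathematicalPhysics.QuantumFieldTheory.MassGapFromLatticeClustering

/-!
# Route-context READ-BACK of the children list (V, I, U_gap) — crux stmt-QuantumFields-10522, seat c12

Mirrors the strategist's `SplitReadback.lean` (V, I, U) with child U re-typed in GAP CURRENCY (U_gap, adopted from the (B)-chain
lead's banner (c′), `Cruxes/LatticeGapOnTrajectory/RESTATE-B-c9.md`). Imports exactly what the route file
`Theses/ParabolicTrajectory.lean` would import after the split (its current imports + `MassGapFromLatticeClustering` for
`SpeciesScheme.HasCSClustering`, the per-child `imports` of `children-gap.json`) and NO `Summits.…Theorems` module; replicates the route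
file's `open` lines; renders the three children VERBATIM as `children-gap.json` states them (one-line Props with an `open … in` prefix)
inside the route namespace — i.e. exactly as the gate would write them — and proves the split glue
`V → I → U_gap → ContinuumLimitOnTrajectory` against the LIVE crux decl by pure logic (the proof a prover pastes for the glue item if
`--glue-by Summit.QuantumFields.YangMills.Cruxes.ContinuumLimitOnTrajectory.RegimeTrisection.ContinuumLimitOnTrajectory_of` is unavailable).
The `Iff.rfl` identities with the landed Theorems-side names (`RegimeTrisection.ForcedVolumeGrowth`, `.ClusteringOnTrajectory`,
`TrisectionGap.UltravioletLimitWithGapOnTrajectory`) are certified in `Lines/regime_trisection.lean` v3 §3 and in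
`Cruxes/LatticeGapOnTrajectory/SplitDefeqCheckB.lean`. Scratch (not landed). rc 0, 0 sorry expected.
-/

namespace Summit.QuantumFields.YangMills.Theses.ParabolicTrajectory.SplitScratchGap

open scoped BigOperators Topology Manifold Classical MeasureTheory ProbabilityTheory Matrix InnerProductSpace ComplexConjugate ContinuousMap
open Filter Set Function TopologicalSpace MeasureTheory

/-- child V (route-item rendering; QUARANTINED artefact, to be dropped with the parent). -/
def ForcedVolumeGrowth : Prop :=
  open Literature.MathematicalPhysics.QuantumFieldTheory Literature.MathematicalPhysics.QuantumLattice Literature.MathematicalPhysics.AQFT Classical in ∀ (G : Type) [Group G] [TopologicalSpace G] [IsTopologicalGroup G] [CompactSpace G] [MeasurableSpace G] [BorelSpace G], IsCompactSimpleLieGroup G → ∀ (r : LatticeRep G) (M : ℕ) (θ Δ : ℝ) (sch : SpeciesScheme (YMSpecies G)) (n : ℕ → ℕ), 0 < θ → 0 < Δ → (∀ k, sch.a k = ((M : ℝ) ^ n k)⁻¹) → Filter.Tendsto sch.β Filter.atTop Filter.atTop → (∀ t : ℕ, 0 < t → ∃ c : ℝ, Filter.Tendsto (fun k => ((M : ℝ)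 ^ n k) ^ 8 * latticeConnectedCorr r.ρ (sch.β k) (sch.side k) r.curvature.F r.curvature.F (t * M ^ n k)) Filter.atTop (nhds c)) → Filter.Tendsto (fun k => ((M : ℝ) ^ n k) ^ 8 * latticeConnectedCorr r.ρ (sch.β k) (sch.side k) r.curvature.F r.curvature.F (M ^ n k)) Filter.atTop (nhds θ) → HasLatticeMassGap r sch Δ → ∃ N : ℕ, 1 ≤ N ∧ ∀ᶠ k in Filter.atTop, (sch.a k)⁻¹ ≤ (sch.a k * (sch.L k : ℝ)) ^ N

/-- child I (route-item rendering; the infrared bridge). -/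
def ClusteringOnTrajectory : Prop :=
  open Literature.MathematicalPhysics.QuantumFieldTheory Literature.MathematicalPhysics.QuantumLattice Literature.MathematicalPhysics.AQFT Classical in ∀ (G : Type) [Group G] [TopologicalSpace G] [IsTopologicalGroup G] [CompactSpace G] [MeasurableSpace G] [BorelSpace G], IsCompactSimpleLieGroup G → ∀ (r : LatticeRep G) (M : ℕ) (θ Δ : ℝ) (sch : SpeciesScheme (YMSpecies G)) (n : ℕ → ℕ), 0 < θ → 0 < Δ → (∀ k, sch.a k = ((M : ℝ) ^ n k)⁻¹) → Filter.Tendsto sch.β Filter.atTop Filter.atTop → (∀ t : ℕ, 0 < t → ∃ c : ℝ, Filter.Tendsto (fun k => ((M : ℝ) ^ n k) ^ 8 * latticeConnectedCorr r.ρ (sch.β k) (sch.side k) r.curvature.F r.curvature.F (t * M ^ n k)) Filter.atTop (nhds c)) → Filter.Tendsto (fun k => ((M : ℝ) ^ n k) ^ 8 * latticeConnectedCorr r.ρ (sch.β k) (sch.side k) r.curvature.F r.curvature.F (M ^ n k)) Filter.atTop (nhds θ) → HasLatticeMassGap r sch Δ → (∃ N : ℕ, 1 ≤ N ∧ ∀ᶠ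 k in Filter.atTop, (sch.a k)⁻¹ ≤ (sch.a k * (sch.L k : ℝ)) ^ N) → let cn : SpeciesScheme (YMSpecies G) := { a := sch.a, a_pos := sch.a_pos, tendsto_a := sch.tendsto_a, β := sch.β, L := sch.L, tendsto_L := sch.tendsto_L, c := fun s k => if s = r.curvature then ((sch.a k) ^ 4)⁻¹ else 0, m := fun s k => wilsonTorusMean r.ρ (sch.β k) (sch.L k) s.F }; ((∀ (p : ℕ) (f : Fin p → SchwartzMap (EuclideanSpace ℝ (Fin 4)) ℝ), IsOffDiagonal (SchwartzMap.tensorFin p fun i => ofRealTest (f i)) → ∀ ε : ℝ, 0 < ε → ∀ᶠ k in Filter.atTop, ∀ L : ℕ, sch.L k ≤ L → |latticeSchwinger r.ρ cn (fun s => s.F) k p (fun _ => r.curvature) f - wilsonCentredSchwinger r.ρ (sch.β k) L (fun _ => 1) p (fun _ => r.curvature) (fun i => (blockDilate M)^[n k] (f i))| ≤ ε) ∧ (∀ t : ℕ, 0 < t → ∀ ε : ℝ, 0 < ε → ∀ᶠ k in Filter.atTop, ∀ S : ℕ, sch.L k ≤ S → ((M : ℝ) ^ n k) ^ 8 * |latticeConnectedCorr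 r.ρ (sch.β k) (sch.side k) r.curvature.F r.curvature.F (t * M ^ n k) - latticeConnectedCorr r.ρ (sch.β k) (2 * S + 1) r.curvature.F r.curvature.F (t * M ^ n k)| ≤ ε)) ∧ ∃ Δ₁ : ℝ, 0 < Δ₁ ∧ SpeciesScheme.HasCSClustering r cn Δ₁

/-- child U_gap (route-item rendering; the ultraviolet crux in gap currency). -/
def UltravioletLimitWithGapOnTrajectory : Prop :=
  open Literature.MathematicalPhysics.QuantumFieldTheory Literature.MathematicalPhysics.QuantumLattice Literature.MathematicalPhysics.AQFT Classical in ∀ (G : Type) [Group G] [TopologicalSpace G] [IsTopologicalGroup G] [CompactSpace G] [MeasurableSpace G] [BorelSpace G], IsCompactSimpleLieGroup G → ∀ (r : LatticeRep G), ∃ M₀ : ℕ, ∀ M : ℕ, M₀ ≤ M → 2 ≤ M → ∃ θ₀ : ℝ, 0 < θ₀ ∧ ∀ (θ Δ : ℝ) (sch : SpeciesScheme (YMSpecies G)) (n : ℕ → ℕ), 0 < θ → θ < θ₀ → 0 < Δ → (∀ k, sch.a k = ((M : ℝ) ^ n k)⁻¹) → Filter.Tendsto sch.β Filter.atTop Filter.atTop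 → (∀ t : ℕ, 0 < t → ∃ c : ℝ, Filter.Tendsto (fun k => ((M : ℝ) ^ n k) ^ 8 * latticeConnectedCorr r.ρ (sch.β k) (sch.side k) r.curvature.F r.curvature.F (t * M ^ n k)) Filter.atTop (nhds c)) → Filter.Tendsto (fun k => ((M : ℝ) ^ n k) ^ 8 * latticeConnectedCorr r.ρ (sch.β k) (sch.side k) r.curvature.F r.curvature.F (M ^ n k)) Filter.atTop (nhds θ) → HasLatticeMassGap r sch Δ → (∃ N : ℕ, 1 ≤ N ∧ ∀ᶠ k in Filter.atTop, (sch.a k)⁻¹ ≤ (sch.a k * (sch.L k : ℝ)) ^ N) → let cn : SpeciesScheme (YMSpecies G) := { a := sch.a, a_pos := sch.a_pos, tendsto_a := sch.tendsto_a, β := sch.β, L := sch.L, tendsto_L := sch.tendsto_L, c := fun s k => if s = r.curvature then ((sch.a k) ^ 4)⁻¹ else 0, m := fun s k => wilsonTorusMean r.ρ (sch.β k) (sch.L k) s.F }; ((∀ (p : ℕ) (f : Fin p → SchwartzMap (EuclideanSpace ℝ (Fin 4)) ℝ), IsOffDiagonal (SchwartzMap.tensorFin p fun i => ofRealTest (f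 i)) → ∀ ε : ℝ, 0 < ε → ∀ᶠ k in Filter.atTop, ∀ L : ℕ, sch.L k ≤ L → |latticeSchwinger r.ρ cn (fun s => s.F) k p (fun _ => r.curvature) f - wilsonCentredSchwinger r.ρ (sch.β k) L (fun _ => 1) p (fun _ => r.curvature) (fun i => (blockDilate M)^[n k] (f i))| ≤ ε) ∧ (∀ t : ℕ, 0 < t → ∀ ε : ℝ, 0 < ε → ∀ᶠ k in Filter.atTop, ∀ S : ℕ, sch.L k ≤ S → ((M : ℝ) ^ n k) ^ 8 * |latticeConnectedCorr r.ρ (sch.β k) (sch.side k) r.curvature.F r.curvature.F (t * M ^ n k) - latticeConnectedCorr r.ρ (sch.β k) (2 * S + 1) r.curvature.F r.curvature.F (t * M ^ n k)| ≤ ε)) → (∃ Δ₁ : ℝ, 0 < Δ₁ ∧ SpeciesScheme.HasCSClustering r cn Δ₁) → ∃ sch' : SpeciesScheme (YMSpecies G), sch'.a = sch.a ∧ sch'.β = sch.β ∧ sch'.L = sch.L ∧ ∃ T : OSData (YMSpecies G) 4, IsYangMillsFor r sch' T ∧ T.IsNontrivial r.curvature ∧ T.IsNonGaussian r.curvature ∧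 ∃ Δ₁ : ℝ, 0 < Δ₁ ∧ T.HasMassGap Δ₁

/-- The split glue in the route context: `V → I → U_gap → (A)` (pure logic; `M₀`, `θ₀` from U_gap, V supplies the growth clause,
I the infrared data, and the gap conjunct of U_gap is dropped). -/
theorem ContinuumLimitOnTrajectory_of_subs_gap :
    ForcedVolumeGrowth → ClusteringOnTrajectory → UltravioletLimitWithGapOnTrajectory → ContinuumLimitOnTrajectory := by
  intro hV hI hU G _ _ _ _ hG
  letI : MeasurableSpace G := borel G
  haveI : BorelSpace G := ⟨rfl⟩
  intro r
  obtain ⟨M₀, hM₀⟩ := hU G hG r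
  refine ⟨M₀, fun M hM h2 => ?_⟩
  obtain ⟨θ₀, hθ₀, hall⟩ := hM₀ M hM h2
  refine ⟨θ₀, hθ₀, fun θ Δ sch n hθ hθθ hΔ hshape hβ htower htune hgap => ?_⟩
  have hgrowth := hV G hG r M θ Δ sch n hθ hΔ hshape hβ htower htune hgap
  have hIR := hI G hG r M θ Δ sch n hθ hΔ hshape hβ htower htune hgap hgrowth
  obtain ⟨sch', ha, hb, hL, T, hYM, hNT, hNG, -⟩ :=
    hall θ Δ sch n hθ hθθ hΔ hshape hβ htower htune hgap hgrowth hIR.1 hIR.2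
  exact ⟨sch', ha, hb, hL, T, hYM, hNT, hNG⟩

/- Remark (not a theorem): U_gap is NOT implied by the parent (A) — the gap conjunct is new content relative to (A) (it is implied by
the (A) chain's gap-currency restatement `ContinuumLimitWithGapPVG`, landed read-back
`TrisectionGap.ultravioletLimitWithGapOnTrajectory_of_withGapPVG`); that conjunct is exactly what makes the rev-8 `closes`
independent of (B)'s filed transfer clause. -/

end Summit.QuantumFields.YangMills.Theses.ParabolicTrajectory.SplitScratchGap
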